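import Literature.AlgebraicGeometry.HodgeTheory.HodgeClassOfMorphism
import Literature.AlgebraicGeometry.HodgeTheory.HodgeClassOfMorphismProofs
import Literature.NumberTheory.Transcendental.DeRhamTheoremMultiplicative
import HarnessLib

/-!
# Voisin I, Lemma 11.41: the named fact `exists_hodgeClass_corrAction_eq_smul` from de Rham's theorem

Family `hodge`, layer `Literature/AlgebraicGeometry/HodgeTheory`. Assembly (fact-decompose) of the
named fact `exists_hodgeClass_corrAction_eq_smul` (file `HodgeClassOfMorphism`: a rational
type-`(r, r)` map `φ : Hᵃ(X(ℂ)) → Hᵇ(Y(ℂ))` is `t • γ_*` for a rational Hodge class `γ` of type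
`(e, e)` on `Y ⊗ X`; C. Voisin, *Hodge Theory and Complex Algebraic Geometry I* (2002), §11.3.3
Lemma 11.41 with Thm. 11.38 and Poincaré duality) from the tree's theorem
`exists_hodgeClass_corrAction_eq_smul_of_multiplicative_deRham` (file `HodgeClassOfMorphismProofs`)
and de Rham's theorem in multiplicative form,
`Literature.NumberTheory.Transcendental.exists_deRhamIsoFamily 𝓘(ℝ, E)` for every
finite-dimensional complex model space `E` (Warner Thm. 5.45: the integration isomorphism takes
`∧` to `∪`), which feeds `CupPreservesHodgeType` (cup products add Hodge types, Voisin I Thm. 5.29)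
on `X` and on `Y ⊗ X` and which the tree PROVES (`exists_deRhamIsoFamily_holds`, file
`NumberTheory/Transcendental/DeRhamTheoremMultiplicative`). Hence the DISCHARGE
`exists_hodgeClass_corrAction_eq_smul_holds` (D-0014: the fact becomes a theorem; debt -1).

## References

* [VoisinHodgeI2002] C. Voisin, Hodge Theory and Complex Algebraic Geometry I, CUP 2002, §11.3.3
  Thm. 11.38 and Lemma 11.41; §5.3.2 Thm. 5.29.
* [WarnerGTM94] F. W. Warner, Foundations of Differentiable Manifolds and Lie Groups, Thm. 5.45.
-/

noncomputable section

open scoped Manifold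

namespace Literature.AlgebraicGeometry.HodgeTheory

section HodgeTheory

/-- **`exists_hodgeClass_corrAction_eq_smul` (Voisin I, Lemma 11.41) holds, granted de Rham's
theorem in multiplicative form** (`exists_deRhamIsoFamily 𝓘(ℝ, E)` for all finite-dimensional
complex `E`): `exists_hodgeClass_corrAction_eq_smul_of_multiplicative_deRham` in the binder shape of
the named fact. Relies on: the hypothesis `hdR` (an unproved named fact) only.
[cite: VoisinHodgeI2002, §11.3.3 Thm. 11.38 and Lemma 11.41] [cite: WarnerGTM94, Thm. 5.45] -/
theorem exists_hodgeClass_corrAction_eq_smul_of_exists_deRhamIsoFamily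
    (hdR : ∀ (E : Type) [NormedAddCommGroup E] [NormedSpace ℂ E] [FiniteDimensional ℂ E],
      Literature.NumberTheory.Transcendental.exists_deRhamIsoFamily 𝓘(ℝ, E)) :
    exists_hodgeClass_corrAction_eq_smul :=
  fun _ _ _ _ hY hX A B _ _ _ _ hab hr φ hφ hφH μ ↦
    exists_hodgeClass_corrAction_eq_smul_of_multiplicative_deRham hdR hY hX A B hab hr φ hφ hφH μ

/-- **DISCHARGE of the named fact `exists_hodgeClass_corrAction_eq_smul`** (Voisin I, Lemma 11.41
with Künneth and Poincaré duality, on the tree's carriers): de Rham's theorem in multiplicative form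
is the tree's theorem `exists_deRhamIsoFamily_holds`. Relies on: nothing unproved.
[cite: VoisinHodgeI2002, §11.3.3 Thm. 11.38 and Lemma 11.41] [cite: WarnerGTM94, Thm. 5.45] -/
theorem exists_hodgeClass_corrAction_eq_smul_holds : exists_hodgeClass_corrAction_eq_smul :=
  exists_hodgeClass_corrAction_eq_smul_of_exists_deRhamIsoFamily
    fun E _ _ _ ↦ Literature.NumberTheory.Transcendental.exists_deRhamIsoFamily_holds E

end HodgeTheory

end Literature.AlgebraicGeometry.HodgeTheory

end
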